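import Mathlib
import Summits.Ventures.HodgeRepro2.T5AdicCompletionResidueField
import Summits.Ventures.HodgeRepro2.T5AdicCompletionIntegral
import Summits.Ventures.HodgeRepro2.T5ConductorExistence
import Summits.Ventures.HodgeRepro2.T5LocalFieldDictionary
import Summits.Ventures.HodgeRepro2.T5RamificationIndexUniformizer

/-!
# T5AdicCompletionInert — characters of exact level `n` trivial on `O_Kvˣ` exist at an inert
place of Mathlib's number-field completions ((A10), local half, on the concrete pair)

Blind cell pub-hodge-repro2, seat p4 (Tier-5 Lean support, annex growth only).
Declaration per README §8(d): uses an L-value-free non-vanishing device: NO.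

Row 45 (p392369, `T5ConductorExistence.exists_character_exact_level`) proves, for an abstract
pair of DVRs `R → S` with a common uniformiser `ϖ`, finite residue field of `S` and a
NON-SURJECTIVE residue map `R ⧸ (ϖ) → S ⧸ (ϖ)`, that for every `n` there is a character
`χ : Sˣ →* ℂˣ` trivial on `U_{n+1}` and on the image of `Rˣ` but not on `U_n` — the (A10)
statement «`U_E^{a-1}/U_E^a ≅ k_E` is strictly larger than the image of `U_F`, so a character of
exact conductor `a` trivial on `U_F` exists». On Mathlib's completions `O_Kv → O_Lw` of number
fields at an INERT place (`ϖ` stays a uniformiser and the residue degree is `≥ 2`) every hypothesis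
is now supplied: the residue field of `O_Lw` is finite (p396054), and the residue map is not onto
because `f = finrank (O_Kv ⧸ (ϖ)) (O_Lw ⧸ (ϖ)) ≥ 2` (`not_surjective_residueMap_of_two_le_inertiaDeg'`,
general for DVR pairs). In the quadratic case `[Lw : Kv] = 2` the inertness `Irreducible
(algebraMap ϖ)` alone gives `f = 2` through `e · f = [Lw : Kv]` (p395866).
Nothing here is asserted about the Tier-5 datum.
-/

namespace Summit.Ventures.HodgeRepro2.T5AdicCompletionInert

open IsDedekindDomain HeightOneSpectrum NumberField IsLocalRing
open scoped WithZero

/-! ## §1 A non-surjective residue map from a residue degree `≥ 2` (abstract DVR pair) -/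

section Abstract

variable {A B : Type*} [CommRing A] [CommRing B] [Algebra A B] [IsDomain A]
  [IsDiscreteValuationRing A] [IsDomain B] [IsDiscreteValuationRing B]

/-- `(ϖ)` is maximal in a DVR for irreducible `ϖ`. -/
theorem span_isMaximal {ϖ : A} (hϖ : Irreducible ϖ) : (Ideal.span {ϖ}).IsMaximal := by
  rw [← (IsDiscreteValuationRing.irreducible_iff_uniformizer ϖ).mp hϖ]
  exact maximalIdeal.isMaximal A

omit [IsDomain A] [IsDiscreteValuationRing A] [IsDomain B] [IsDiscreteValuationRing B] in
/-- Row 44's residue map `A ⧸ (ϖ) → B ⧸ (algebraMap ϖ)` is the algebra map of Mathlib's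
`algebraOfLiesOver` structure. -/
theorem residueMap_eq_algebraMap (ϖ : A) [(Ideal.span {algebraMap A B ϖ}).LiesOver (Ideal.span {ϖ})]
    (c : A ⧸ Ideal.span {ϖ}) :
    T5PrincipalUnitComparison.residueMap ϖ c =
      algebraMap (A ⧸ Ideal.span {ϖ}) (B ⧸ Ideal.span {algebraMap A B ϖ}) c := by
  obtain ⟨x, rfl⟩ := Ideal.Quotient.mk_surjective c
  rfl

/-- If the residue degree `f = inertiaDeg' (ϖ) (algebraMap ϖ)` is `≥ 2`, the residue map is not
onto: a surjective algebra map between the residue fields would make the extension of degree `≤ 1`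
(`finrank_le_one` with the generator `1`). -/
theorem not_surjective_residueMap_of_two_le_inertiaDeg' {ϖ : A} (hϖ : Irreducible ϖ)
    (hϖ' : Irreducible (algebraMap A B ϖ))
    [(Ideal.span {algebraMap A B ϖ}).LiesOver (Ideal.span {ϖ})]
    (hf : 2 ≤ (Ideal.span {ϖ}).inertiaDeg' (Ideal.span {algebraMap A B ϖ})) :
    ¬ Function.Surjective (T5PrincipalUnitComparison.residueMap (S := B) ϖ) := by
  intro hsurj
  haveI hp : (Ideal.span {ϖ}).IsMaximal := span_isMaximal hϖ
  haveI hP : (Ideal.span {algebraMap A B ϖ}).IsMaximal := span_isMaximal hϖ'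
  have h1 : (Ideal.span {ϖ}).inertiaDeg' (Ideal.span {algebraMap A B ϖ}) =
      Module.finrank (A ⧸ Ideal.span {ϖ}) (B ⧸ Ideal.span {algebraMap A B ϖ}) := by
    rw [Ideal.inertiaDeg'_eq_inertiaDeg (Ideal.span {ϖ}) (Ideal.span {algebraMap A B ϖ}),
      Ideal.inertiaDeg_eq_of_isMaximal (Ideal.span {ϖ}) (Ideal.span {algebraMap A B ϖ})]
  have h2 : Module.finrank (A ⧸ Ideal.span {ϖ}) (B ⧸ Ideal.span {algebraMap A B ϖ}) ≤ 1 :=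
    finrank_le_one (1 : B ⧸ Ideal.span {algebraMap A B ϖ}) fun w => by
      obtain ⟨c, hc⟩ := hsurj w
      exact ⟨c, by rw [← hc, residueMap_eq_algebraMap]; exact (Algebra.algebraMap_eq_smul_one c).symm⟩
  omega

end Abstract

/-! ## §2 The concrete inert pair -/

section Concrete

variable {K : Type*} [Field K] [NumberField K] (v : HeightOneSpectrum (𝓞 K))
variable {L : Type*} [Field L] [NumberField L] [Algebra K L] (w : HeightOneSpectrum (𝓞 L))
variable [Algebra (v.adicCompletion K) (w.adicCompletion L)]
  [ContinuousSMul (v.adicCompletion K) (w.adicCompletion L)]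
  [IsScalarTower K (v.adicCompletion K) (w.adicCompletion L)]

/-- `(algebraMap ϖ)` lies over `(ϖ)` when both are irreducible (p394509). -/
theorem liesOver_span_algebraMap {ϖ : v.adicCompletionIntegers K} (hϖ : Irreducible ϖ)
    (hϖ' : Irreducible (algebraMap (v.adicCompletionIntegers K) (w.adicCompletionIntegers L) ϖ)) :
    (Ideal.span {algebraMap (v.adicCompletionIntegers K) (w.adicCompletionIntegers L) ϖ}).LiesOver
      (Ideal.span {ϖ}) :=
  T5LocalFieldDictionary.span_liesOver (v.adicCompletionIntegers K) (w.adicCompletion L)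
    (w.adicCompletionIntegers L) _ hϖ' ϖ hϖ

/-- (A10) ON THE CONCRETE INERT PAIR: if the uniformiser `ϖ` of `O_Kv` stays a uniformiser of
`O_Lw` and the residue degree is `≥ 2`, then for every `n` there is a character `χ` of `O_Lwˣ`
trivial on `U_{n+1}` and on the image of `O_Kvˣ`, and non-trivial on `U_n` (row 45 with the
finite residue field of p396054 and the non-surjectivity of §1). -/
theorem exists_character_exact_level {ϖ : v.adicCompletionIntegers K} (hϖ : Irreducible ϖ)
    (hϖ' : Irreducible (algebraMap (v.adicCompletionIntegers K) (w.adicCompletionIntegers L) ϖ))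
    (hf : 2 ≤ (Ideal.span {ϖ}).inertiaDeg'
      (Ideal.span {algebraMap (v.adicCompletionIntegers K) (w.adicCompletionIntegers L) ϖ}))
    (n : ℕ) :
    ∃ χ : (w.adicCompletionIntegers L)ˣ →* ℂˣ,
      (∀ u ∈ T5PrincipalUnitFiltration.higherUnits
        (algebraMap (v.adicCompletionIntegers K) (w.adicCompletionIntegers L) ϖ) (n + 1), χ u = 1) ∧
      (∀ r : (v.adicCompletionIntegers K)ˣ, χ (T5PrincipalUnitComparison.unitsMap r) = 1) ∧
      ∃ u ∈ T5PrincipalUnitFiltration.higherUnits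
        (algebraMap (v.adicCompletionIntegers K) (w.adicCompletionIntegers L) ϖ) n, χ u ≠ 1 := by
  haveI := liesOver_span_algebraMap v w hϖ hϖ'
  exact T5ConductorExistence.exists_character_exact_level ϖ
    T5ContinuousValuationExtension.algebraMap_adicCompletionIntegers_injective hϖ hϖ'
    (not_surjective_residueMap_of_two_le_inertiaDeg' hϖ hϖ' hf) n

omit [Algebra K L] [IsScalarTower K (v.adicCompletion K) (w.adicCompletion L)] in
/-- `e = 1` for the pair `(ϖ, algebraMap ϖ)` when `algebraMap ϖ` is irreducible. -/
theorem ramificationIdx'_span_algebraMap_eq_one {ϖ : v.adicCompletionIntegers K}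
    (hϖ' : Irreducible (algebraMap (v.adicCompletionIntegers K) (w.adicCompletionIntegers L) ϖ)) :
    (Ideal.span {ϖ}).ramificationIdx'
      (Ideal.span {algebraMap (v.adicCompletionIntegers K) (w.adicCompletionIntegers L) ϖ}) = 1 :=
  T5RamifiedQuadraticDictionary.ramificationIdx'_eq_of_algebraMap_eq_unit_mul_pow ϖ _ hϖ' 1 1
    (by simp)

/-- At a QUADRATIC INERT place (`[Lw : Kv] = 2`, `ϖ` stays a uniformiser) the residue degree is
`2` (`e · f = [Lw : Kv]`, p395866). -/
theorem inertiaDeg'_eq_two_of_quadratic_inert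
    (h2 : Module.finrank (v.adicCompletion K) (w.adicCompletion L) = 2)
    {ϖ : v.adicCompletionIntegers K} (hϖ : Irreducible ϖ)
    (hϖ' : Irreducible (algebraMap (v.adicCompletionIntegers K) (w.adicCompletionIntegers L) ϖ)) :
    (Ideal.span {ϖ}).inertiaDeg'
      (Ideal.span {algebraMap (v.adicCompletionIntegers K) (w.adicCompletionIntegers L) ϖ}) = 2 := by
  have := T5AdicCompletionIntegral.ramificationIdx'_mul_inertiaDeg'_eq_finrank v w ϖ hϖ _ hϖ'
  rwa [ramificationIdx'_span_algebraMap_eq_one v w hϖ', one_mul, h2] at this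

/-- (A10) AT A QUADRATIC INERT PLACE: `[Lw : Kv] = 2` and `ϖ` a common uniformiser give, for every
`n`, a character of `O_Lwˣ` of exact level `n` trivial on the image of `O_Kvˣ`. -/
theorem exists_character_exact_level_of_quadratic_inert
    (h2 : Module.finrank (v.adicCompletion K) (w.adicCompletion L) = 2)
    {ϖ : v.adicCompletionIntegers K} (hϖ : Irreducible ϖ)
    (hϖ' : Irreducible (algebraMap (v.adicCompletionIntegers K) (w.adicCompletionIntegers L) ϖ))
    (n : ℕ) :
    ∃ χ : (w.adicCompletionIntegers L)ˣ →* ℂˣ,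
      (∀ u ∈ T5PrincipalUnitFiltration.higherUnits
        (algebraMap (v.adicCompletionIntegers K) (w.adicCompletionIntegers L) ϖ) (n + 1), χ u = 1) ∧
      (∀ r : (v.adicCompletionIntegers K)ˣ, χ (T5PrincipalUnitComparison.unitsMap r) = 1) ∧
      ∃ u ∈ T5PrincipalUnitFiltration.higherUnits
        (algebraMap (v.adicCompletionIntegers K) (w.adicCompletionIntegers L) ϖ) n, χ u ≠ 1 :=
  exists_character_exact_level v w hϖ hϖ'
    (by rw [inertiaDeg'_eq_two_of_quadratic_inert v w h2 hϖ hϖ']) n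

end Concrete

end Summit.Ventures.HodgeRepro2.T5AdicCompletionInert
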